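import Summits.CriticalPhenomena.PercolationContinuityZ3.Theorems.PercNearOneGluingNoHeavyQuantGatedSliceMixLawHeavyTop
import Summits.CriticalPhenomena.PercolationContinuityZ3.Theorems.PercNearOneGluingNoHeavyQuantWindowMix
import Summits.CriticalPhenomena.PercolationContinuityZ3.Theorems.PercNearOneGluingNoHeavyQuantConvHeavy
import Summits.CriticalPhenomena.PercolationContinuityZ3.Theorems.PercNearOneGluingNoHeavyQuantGatedConvSplit
import Summits.CriticalPhenomena.PercolationContinuityZ3.Theorems.PercNearOneGluingNoHeavyQuantLawDecFlowsDecomposition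
import HarnessLib

/-!
# QUANT lane R8, T-DEC, leg (III), GENERAL SECOND FACTOR: `SDECUpTo` is closed under convolution with ANY HEAVY TWO-POINT MIXTURE —
# `WindowMixDEC ⟹ SingleGateConvClosed`'s conclusion for every heavy-decomposable second factor; UNCONDITIONAL for a gapped first factor
# and for two heavy mixtures (the gated shift carries the blob step through every mean-`T₂` component of `μ₂`)

builds on p205010 (kernel theorem, internal audit signed; external expert review pending)

Support file (`--supports stmt-CriticalPhenomena-4575`), QUANT lane seat prim-quant-arm-2 (gen 35), rung R8 of
`run/shared/lean/prim/quant/LADDER.md`.  Theorems only, standard axioms, no sorries, no definitions.  Continues this seat's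
`…QuantGapSliceTwoBlob` / `…QuantGatedSliceMixLawHeavyTop`, lead g31's `…QuantWindowMix` (`sdecUpTo_slice_of_windowMix : WindowMixDEC → …`),
typer g26's `…QuantGatedShiftDECHolds` (`gatedShift_sdecUpTo`), typer g22's `…QuantDECAtTMixtures` (`decAtT_finite_mixture`) and the
convolution bookkeeping of `…QuantConvHeavy` (`lconv_TP`) / `…QuantGatedConvSplit` (`lconv_comm`).

THE REDUCTION (arm-2 g35; lead g31's GEN-32 look-ahead N122–N123 asked for the architecture of the general second factor of
`SingleGateConvClosed`).  Write the second factor as a finite mixture of two-point laws of its own mean, `μ₂ = Σ_i w_i·{lo i, hi i; γ i}`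
(Lemma P, `exists_twoPoint_decomposition_TA`, always possible).  Since the gate is affine and the convolution bilinear,
    `gate_q(μ₁ ∗ μ₂) = Σ_i w_i · gate_q(μ₁ ∗ {lo i, hi i; γ i})`,   `μ₁ ∗ {lo, hi; γ} = shift_lo (slice μ₁ (hi − lo) γ)`,
and EVERY piece has the same gated mean `q(T₁ + T₂)` (the components share the mean `T₂`), so `decAtT_finite_mixture` applies at the common
target.  A piece is the GATED SHIFT by `lo` of the blob-step law `gate_q(μ₁ ∗ {0, hi−lo; γ})`: typer g26's theorem `gatedShift_sdecUpTo`
(Conjecture R: SDEC-up-to-`Q` survives shifting everything but the gate zero) reduces it to the BLOB STEP for the blob `{0, hi − lo; γ}` beside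
`μ₁`, which is (i) CW (`WindowMixDEC`, via `sdecUpTo_slice_of_windowMix`) when `γ ≥ x`, (ii) UNCONDITIONAL when `μ₁` has no atom strictly inside
`(0, hi − lo)` (`sdecUpTo_slice_of_gap`), (iii) UNCONDITIONAL when `μ₁` is itself a heavy two-point mixture (commute; the blob `{0, b; γ′}` is
gapped; the slices of its pieces are two-blob laws, `sdecUpTo_twoBlob`).  HEAVINESS `γ i ≥ x` of every component is what CW needs
(`y ≤ (1−z)·g`); NO DEC hypothesis on `μ₂` is used at all.

* `gate_sum_mixture`, `lconv_TP_eq_shift_slice`, `slice_zero_size`, `twoPointMix_laws` — bookkeeping.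
* **`sdecUpTo_lconv_twoPointMix`** — MASTER LEMMA: `SDECUpTo x Q M₁ μ₁` + every charged blob slice `slice μ₁ (hi i − lo i) (γ i)` SDEC up to
  `Q` ⟹ `SDECUpTo x Q (M₁+M₂) (lconv μ₁ μ₂)` for `μ₂` a finite mixture of common-mean two-point laws.
* **`sdecUpTo_lconv_heavyMix_of_windowMix : WindowMixDEC → …`** — CW ⟹ the conclusion of `SingleGateConvClosed` (in `SDECUpTo` form, all
  gates `q ≤ Q`) for EVERY top-affordable SDEC first factor and EVERY heavy-decomposable second factor; primed form with heaviness / common mean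
  asked of the charged genuine components only (Lemma P's output); **`sdecUpTo_lconv_zeroOrBig_of_windowMix`** — CW ⟹ the same for every
  second factor whose only atom below its mean is `0` (its Lemma-P pairs are `{0, h; T₂/h}`, heavy by top-affordability).
* **`sdecUpTo_lconv_heavyMix_of_gap`** (unconditional) — the same for a first factor with no atom strictly inside `(0, A)` and blob sizes `≤ A`.
* **`sdecUpTo_lconv_heavyMix_heavyMix`** (unconditional) — both factors heavy two-point mixtures: `SingleGateConvClosed` HOLDS for all such pairs
  (self-standing gated two-point laws with heavy tops, blob laws — BLOB-DEC(2) under a common gate —, laws whose only atom below the mean is `0`).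
WHAT IS LEFT of the general second factor, GIVEN CW: second factors that are NOT heavy mixtures at the base floor `x` — some mean-`T₂` pair
`{l, h; γ}` with `l ≥ 1` is LIGHT (`γ < x`; TA forces `l ≥ (h − l)·x(x−γ)/(1−x) > 0`).  Exact census (seat `work/explore/x5.py`): of 600 random
admissible second factors (gated law top-affordable and DEC at every layer, floor pushed to the boundary or interior) 232 are heavy-decomposable,
368 are not; and a light component ALONE can fail under a gate (`x1b.py`: `μ₁ = {0: 1/3, 1: 2/3}`, `q = 3/4`, `y = 1/2`, pair `{1, 9; 21/32}`:
`gate_q(μ₁ ∗ pair)` not DEC at layers 2..8 although `gate_q μ₁` is), so the light residue must use `μ₂`'s own DEC data — it is lead g31's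
"small second factor" setting (LEAD-NOTES-G31 N122–N123), now reduced to second factors CONTAINING A LIGHT PAIR.  For `q = 1` this is
census-2's `LightSliceCore` residue of (II); the gated light residue is the (III) analogue.
HONEST STATUS: `WindowMixDEC`, `GatedSliceMixLaw'`, `SingleGateConvClosed`, `GatedConvEmptyFree`, `SDECConvClosed`, `TreeDEC`, `FarTreeRow` remain
OPEN; the first two theorems below are CONDITIONAL on CW where marked.  The RATE class log\* and the honest sentence of
`run/shared/lean/prim/quant/README.md` are unchanged.

[this work]; gated shift: prim-quant-stmt g26; CW and its `SDECUpTo` corollary: prim-quant-lead g31 / prim-quant-stmt g29; finite mixtures: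
prim-quant-stmt g22; convolution bookkeeping: prim-quant-census-2 g53/g56, prim-quant-stmt g25 (this lane).  Nothing here is cited as a
published result.  The gluing rows served [cite: KozmaNitzan2024, Conjecture 3 (p. 15)]; product measure [cite: Grimmett1999, §1.3 p. 10].
-/

noncomputable section

namespace Summit.CriticalPhenomena.PercolationContinuityZ3.Theorems

namespace Quant

open Finset

/-- the two-point law `{lo, hi; g}` (as in `…QuantLawDEC`) -/
local notation3 "TP[" lo ", " hi ", " g ", " h "]" =>
  (g : ℝ) * (if (h : ℕ) = (hi : ℕ) then (1 : ℝ) else 0) + (1 - (g : ℝ)) * (if (h : ℕ) = (lo : ℕ) then (1 : ℝ) else 0)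

namespace LawDec

/-! ### Bookkeeping: gates of mixtures, the convolution with a two-point law as a shifted slice -/

/-- the gate of a finite mixture (weights summing to `1`) is the mixture of the gates. [this work] -/
theorem gate_sum_mixture {ι : Type} [Fintype ι] (w : ι → ℝ) (ν : ι → ℕ → ℝ) (q : ℝ) (hw1 : ∑ i, w i = 1) (h : ℕ) :
    gate (fun k => ∑ i, w i * ν i k) q h = ∑ i, w i * gate (ν i) q h := by
  simp only [gate]
  have e : ∀ i, w i * (q * ν i h + (if h = 0 then 1 - q else 0)) = q * (w i * ν i h) + w i * (if h = 0 then 1 - q else 0) :=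
    fun i => by ring
  simp_rw [e]
  rw [Finset.sum_add_distrib, ← Finset.mul_sum, ← Finset.sum_mul, hw1, one_mul]

/-- **`μ₁ ∗ {lo, hi; γ}` is the `lo`-shift of the slice `slice μ₁ (hi − lo) γ`** (`lo ≤ hi ≤ M₂`, `μ₁` vanishing above `M₁`). [this work] -/
theorem lconv_TP_eq_shift_slice (M₁ M₂ lo hi : ℕ) (μ₁ : ℕ → ℝ) (γ : ℝ) (h1M : ∀ h, M₁ < h → μ₁ h = 0) (hlohi : lo ≤ hi)
    (hhi : hi ≤ M₂) :
    lconv M₁ M₂ μ₁ (fun k => TP[lo, hi, γ, k]) = fun t => if lo ≤ t then slice μ₁ (hi - lo) γ (t - lo) else 0 := by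
  funext t
  rw [lconv_TP M₁ M₂ lo hi μ₁ γ h1M (hlohi.trans hhi) hhi t]
  simp only [slice]
  by_cases hlo : lo ≤ t
  · rw [if_pos hlo, if_pos hlo]
    by_cases hhi' : hi ≤ t
    · have e1 : hi - lo ≤ t - lo := by omega
      have e2 : t - lo - (hi - lo) = t - hi := by omega
      rw [if_pos hhi', if_pos e1, e2]
    · have e1 : ¬ (hi - lo ≤ t - lo) := by omega
      rw [if_neg hhi', if_neg e1]
  · have hhi' : ¬ (hi ≤ t) := by omega
    rw [if_neg hlo, if_neg hlo, if_neg hhi']; ring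

/-- the trivial slice: `slice μ 0 γ = μ`. [this work] -/
theorem slice_zero_size (μ : ℕ → ℝ) (γ : ℝ) : slice μ 0 γ = μ := by
  funext t; simp only [slice, zero_le, if_true, Nat.sub_zero]; ring

/-- law facts of a finite mixture of two-point laws `{lo i, hi i; γ i}` on `{0..M}` with a common mean `T`. [this work] -/
theorem twoPointMix_laws {ι : Type} [Fintype ι] (M : ℕ) (T : ℝ) (w γ : ι → ℝ) (lo hi : ι → ℕ)
    (hw0 : ∀ i, 0 ≤ w i) (hw1 : ∑ i, w i = 1) (hγ : ∀ i, 0 ≤ γ i ∧ γ i ≤ 1) (hlohi : ∀ i, lo i ≤ hi i) (hhi : ∀ i, hi i ≤ M)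
    (hmeans : ∀ i, 0 < w i → (lo i : ℝ) + ((hi i : ℝ) - lo i) * γ i = T) :
    (∀ h, 0 ≤ ∑ i, w i * TP[lo i, hi i, γ i, h]) ∧ (∀ h, M < h → ∑ i, w i * TP[lo i, hi i, γ i, h] = 0) ∧
      (∑ h ∈ Finset.range (M + 1), ∑ i, w i * TP[lo i, hi i, γ i, h] = 1) ∧
      (∑ h ∈ Finset.range (M + 1), (h : ℝ) * ∑ i, w i * TP[lo i, hi i, γ i, h] = T) := by
  refine ⟨fun h => Finset.sum_nonneg fun i _ => mul_nonneg (hw0 i) ?_, fun h hh => ?_, ?_, ?_⟩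
  · have h1 := (hγ i).1
    have h2 : 0 ≤ 1 - γ i := by linarith [(hγ i).2]
    positivity
  · refine Finset.sum_eq_zero fun i _ => ?_
    have h1 : h ≠ hi i := by have := hhi i; omega
    have h2 : h ≠ lo i := by have := hhi i; have := hlohi i; omega
    rw [if_neg h1, if_neg h2]; ring
  · rw [Finset.sum_comm]
    have e : ∀ i, ∑ h ∈ Finset.range (M + 1), w i * TP[lo i, hi i, γ i, h] = w i := by
      intro i
      rw [← Finset.mul_sum, sum_TP_range M (lo i) (hi i) (γ i) ((hlohi i).trans (hhi i)) (hhi i), mul_one]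
    simp_rw [e]; exact hw1
  · have e0 : ∀ h : ℕ, (h : ℝ) * ∑ i, w i * TP[lo i, hi i, γ i, h] = ∑ i, w i * ((h : ℝ) * TP[lo i, hi i, γ i, h]) := by
      intro h; rw [Finset.mul_sum]; refine Finset.sum_congr rfl fun i _ => ?_; ring
    simp_rw [e0]
    rw [Finset.sum_comm]
    have e : ∀ i, ∑ h ∈ Finset.range (M + 1), w i * ((h : ℝ) * TP[lo i, hi i, γ i, h]) = w i * T := by
      intro i
      rw [← Finset.mul_sum]
      have e1 : ∀ h : ℕ, (h : ℝ) * TP[lo i, hi i, γ i, h]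
          = γ i * (if h = hi i then (h : ℝ) else 0) + (1 - γ i) * (if h = lo i then (h : ℝ) else 0) := fun h => by
        split_ifs <;> ring
      simp_rw [e1]
      rw [Finset.sum_add_distrib, ← Finset.mul_sum, ← Finset.mul_sum, Finset.sum_ite_eq', Finset.sum_ite_eq',
        if_pos (Finset.mem_range.2 (Nat.lt_succ_of_le (hhi i))),
        if_pos (Finset.mem_range.2 (Nat.lt_succ_of_le ((hlohi i).trans (hhi i))))]
      rcases (hw0 i).eq_or_lt with hz | hpos
      · rw [← hz]; ring
      · rw [← hmeans i hpos]; ring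
    simp_rw [e]
    rw [← Finset.sum_mul, hw1, one_mul]

/-! ### THE REDUCTION: a heavy two-point mixture as second factor -/

/-- **MASTER LEMMA (arm-2 g35): `SDECUpTo` IS CLOSED UNDER CONVOLUTION WITH ANY FINITE MIXTURE OF MEAN-`T₂` TWO-POINT LAWS WHOSE BLOB
SLICES OF `μ₁` ARE `SDECUpTo`.**  `μ₁` a top-affordable probability law on `{0..M₁}`, SDEC up to `Q` at floor `x`; `μ₂ = Σ_i w_i·{lo i, hi i; γ i}`
(`w ≥ 0`, `Σ w = 1`, `lo ≤ hi ≤ M₂`, `0 ≤ γ ≤ 1`, ALL of the same mean `T₂`); if for every charged genuine pair the blob slice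
`slice μ₁ (hi i − lo i) (γ i)` is SDEC up to `Q` at `x` on `{0..M₁ + (hi i − lo i)}`, then `lconv μ₁ μ₂` is SDEC up to `Q` at `x` on `{0..M₁+M₂}`.
PROOF: `gate_q(μ₁ ∗ μ₂) = Σ_i w_i · gate_q(μ₁ ∗ {lo i, hi i; γ i})` (the gate is affine), `μ₁ ∗ {lo, hi; γ} = shift_lo (slice μ₁ (hi−lo) γ)`
(`lconv_TP_eq_shift_slice`), typer g26's GATED SHIFT `gatedShift_sdecUpTo` carries `SDECUpTo` of the slice through the shift by `lo`
(the gate zero stays at `0`, the target moves by `q·lo`), every piece has the SAME gated mean `q(T₁ + T₂)` because the components share the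
mean `T₂`, and `decAtT_finite_mixture` reassembles.  No DEC hypothesis on `μ₂` is used. [this work] -/
theorem sdecUpTo_lconv_twoPointMix (x Q T₂ : ℝ) (M₁ M₂ : ℕ) (μ₁ : ℕ → ℝ) {ι : Type} [Fintype ι] (w γ : ι → ℝ) (lo hi : ι → ℕ)
    (hx0 : 0 < x) (hQ1 : Q ≤ 1) (hQx : Q * x < 1)
    (hμ0 : ∀ h, 0 ≤ μ₁ h) (hμM : ∀ h, M₁ < h → μ₁ h = 0) (hμ1 : ∑ h ∈ Finset.range (M₁ + 1), μ₁ h = 1)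
    (hta : x * (M₁ : ℝ) ≤ ∑ h ∈ Finset.range (M₁ + 1), (h : ℝ) * μ₁ h) (hS : SDECUpTo x Q M₁ μ₁)
    (hx1 : x ≤ 1) (hw0 : ∀ i, 0 ≤ w i) (hw1 : ∑ i, w i = 1) (hγ : ∀ i, 0 ≤ γ i ∧ γ i ≤ 1) (hlohi : ∀ i, lo i ≤ hi i)
    (hhi : ∀ i, hi i ≤ M₂) (hheavy : ∀ i, 0 < w i → lo i < hi i → x ≤ γ i)
    (hmeans : ∀ i, 0 < w i → (lo i : ℝ) + ((hi i : ℝ) - lo i) * γ i = T₂)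
    (hslice : ∀ i, 0 < w i → lo i < hi i → SDECUpTo x Q (M₁ + (hi i - lo i)) (slice μ₁ (hi i - lo i) (γ i))) :
    SDECUpTo x Q (M₁ + M₂) (lconv M₁ M₂ μ₁ (fun h => ∑ i, w i * TP[lo i, hi i, γ i, h])) := by
  intro q hq0 hqQ j hj
  set T₁ : ℝ := ∑ h ∈ Finset.range (M₁ + 1), (h : ℝ) * μ₁ h with hT₁
  have hq1 : q ≤ 1 := hqQ.trans hQ1
  have hqx1 : q * x < 1 := lt_of_le_of_lt (mul_le_mul_of_nonneg_right hqQ hx0.le) hQx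
  obtain ⟨m0, mM, m1, mmean⟩ := twoPointMix_laws M₂ T₂ w γ lo hi hw0 hw1 hγ hlohi hhi hmeans
  -- the mean of the gated convolution
  rw [decAt_iff_decAtT, sum_mul_gate, sum_mul_lconv M₁ M₂ μ₁ _ hμ1 m1, mmean]
  -- the gated convolution as a mixture of gated pieces
  have hmix : ∀ h, gate (lconv M₁ M₂ μ₁ (fun k => ∑ i, w i * TP[lo i, hi i, γ i, k])) q h
      = ∑ i, w i * gate (lconv M₁ M₂ μ₁ (fun k => TP[lo i, hi i, γ i, k])) q h := by
    intro h
    rw [← gate_sum_mixture w _ q hw1 h]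
    congr 1
    funext k
    exact lconv_sum_right M₁ M₂ μ₁ w (fun i k => TP[lo i, hi i, γ i, k]) k
  refine decAtT_finite_mixture (q * x) (q * (T₁ + T₂)) j (M₁ + M₂) _ w
    (fun i => gate (lconv M₁ M₂ μ₁ (fun k => TP[lo i, hi i, γ i, k])) q) hw0 hw1 hmix (fun i hi0 => ?_)
  -- one piece: the gated `lo i`-shift of the slice `slice μ₁ a (γ i)`, `a = hi i - lo i`
  set a : ℕ := hi i - lo i with ha
  set Λ : ℕ → ℝ := slice μ₁ a (γ i) with hΛ
  have hΛS : SDECUpTo x Q (M₁ + a) Λ := by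
    rcases Nat.eq_zero_or_pos a with ha0 | hapos
    · rw [hΛ, ha0, slice_zero_size, Nat.add_zero]; exact hS
    · exact hslice i hi0 (by omega)
  have Λ0 : ∀ h, 0 ≤ Λ h := slice_nonneg μ₁ a (γ i) (hγ i).1 (hγ i).2 hμ0
  have ΛM : ∀ h, M₁ + a < h → Λ h = 0 := slice_eq_zero μ₁ a (γ i) M₁ hμM
  have Λ1 : ∑ h ∈ Finset.range (M₁ + a + 1), Λ h = 1 := sum_slice μ₁ a (γ i) M₁ hμM hμ1
  have Λmean : ∑ h ∈ Finset.range (M₁ + a + 1), (h : ℝ) * Λ h = T₁ + (a : ℝ) * γ i := sum_mul_slice μ₁ a (γ i) M₁ hμM hμ1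
  have Λta : x * ((M₁ + a : ℕ) : ℝ) ≤ ∑ h ∈ Finset.range (M₁ + a + 1), (h : ℝ) * Λ h := by
    rw [Λmean]; push_cast
    rcases Nat.eq_zero_or_pos a with ha0 | hapos
    · rw [ha0]; push_cast; linarith
    · have hxγ : x ≤ γ i := hheavy i hi0 (by omega)
      nlinarith [mul_le_mul_of_nonneg_left hxγ (Nat.cast_nonneg a)]
  set Λk : ℕ → ℝ := fun t => if lo i ≤ t then Λ (t - lo i) else 0 with hΛk
  obtain ⟨Λk0, ΛkM, Λk1, Λkmean⟩ := shift_laws (lo i) (M₁ + a) Λ Λ0 ΛM Λ1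
  have hΛkS : SDECUpTo x Q (lo i + (M₁ + a)) Λk := by
    rcases Nat.eq_zero_or_pos (lo i) with hl0 | hlpos
    · have e : Λk = Λ := by
        funext t; rw [hΛk]; simp only [hl0, zero_le, if_true, Nat.sub_zero]
      rw [e, hl0, Nat.zero_add]; exact hΛS
    · exact gatedShift_sdecUpTo x Q (lo i) (M₁ + a) Λ hx0 hx1 hQ1 hQx hlpos Λ0 ΛM Λ1 Λta hΛS
  have hΛkS' : SDECUpTo x q (lo i + (M₁ + a)) Λk := fun q' hq'0 hq'q j' hj' => hΛkS q' hq'0 (hq'q.trans hqQ) j' hj'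
  have Λkta : x * ((lo i + (M₁ + a) : ℕ) : ℝ) ≤ ∑ t ∈ Finset.range (lo i + (M₁ + a) + 1), (t : ℝ) * Λk t := by
    rw [Λkmean]
    have : x * (lo i : ℝ) ≤ lo i := by nlinarith [(Nat.cast_nonneg (lo i) : (0 : ℝ) ≤ lo i)]
    push_cast at Λta ⊢
    nlinarith
  have hNM : lo i + (M₁ + a) ≤ M₁ + M₂ := by have := hhi i; have := hlohi i; omega
  have hdec := decAtT_gate_of_sdecUpTo x q (lo i + (M₁ + a)) (M₁ + M₂) j Λk hx0 hq0 hq1 hqx1 Λk0 ΛkM Λk1 Λkta hΛkS' hNM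
  rw [Λkmean, Λmean] at hdec
  have et : q * (T₁ + (a : ℝ) * γ i + (lo i : ℝ)) = q * (T₁ + T₂) := by
    rw [← hmeans i hi0, ha]; push_cast [Nat.cast_sub (hlohi i)]; ring
  rw [et] at hdec
  have elaw : gate (lconv M₁ M₂ μ₁ (fun k => TP[lo i, hi i, γ i, k])) q = gate Λk q := by
    rw [lconv_TP_eq_shift_slice M₁ M₂ (lo i) (hi i) μ₁ (γ i) hμM (hlohi i) (hhi i)]
  rw [elaw]
  exact hdec

/-- **`WindowMixDEC ⟹ SingleGateConvClosed`'s CONCLUSION FOR EVERY HEAVY-DECOMPOSABLE SECOND FACTOR** (arm-2 g35; leg (III) with a general first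
factor).  Assume CW (`LawDec.WindowMixDEC`).  If `μ₁` is a top-affordable probability law on `{0..M₁}`, SDEC up to `Q` at floor `x`, and `μ₂` is ANY
finite mixture of two-point laws `{lo i, hi i; γ i}` on `{0..M₂}` with a COMMON mean and HEAVY gates `x ≤ γ i ≤ 1`, then `lconv μ₁ μ₂` is SDEC up to
`Q` at `x` on `{0..M₁+M₂}` — i.e. for every gate `q ≤ Q` the law `gate_q(μ₁ ∗ μ₂)` of the two subtrees under a common gate is DEC at every layer at
floor `q·x`.  No DEC hypothesis on `μ₂` is needed (such a `μ₂` is itself SDEC: the case `μ₁ = δ₀`).  By `sdecUpTo_lconv_twoPointMix` with CW's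
corollary `sdecUpTo_slice_of_windowMix` for the blob slices.  So, GIVEN the blob case CW, the general-second-factor problem of `SingleGateConvClosed`
is confined to second factors that are NOT heavy mixtures (some mean-`T₂` pair of `μ₂` must be light, `γ < x`).  CONDITIONAL: the hypothesis
`WindowMixDEC` is `@[conjecture]`. [this work] -/
theorem sdecUpTo_lconv_heavyMix_of_windowMix (hCW : WindowMixDEC) (x Q T₂ : ℝ) (M₁ M₂ : ℕ) (μ₁ : ℕ → ℝ) {ι : Type} [Fintype ι]
    (w γ : ι → ℝ) (lo hi : ι → ℕ)
    (hx0 : 0 < x) (hQ1 : Q ≤ 1) (hQx : Q * x < 1)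
    (hμ0 : ∀ h, 0 ≤ μ₁ h) (hμM : ∀ h, M₁ < h → μ₁ h = 0) (hμ1 : ∑ h ∈ Finset.range (M₁ + 1), μ₁ h = 1)
    (hta : x * (M₁ : ℝ) ≤ ∑ h ∈ Finset.range (M₁ + 1), (h : ℝ) * μ₁ h) (hS : SDECUpTo x Q M₁ μ₁)
    (hw0 : ∀ i, 0 ≤ w i) (hw1 : ∑ i, w i = 1) (hγ : ∀ i, x ≤ γ i ∧ γ i ≤ 1) (hlohi : ∀ i, lo i ≤ hi i) (hhi : ∀ i, hi i ≤ M₂)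
    (hmeans : ∀ i, (lo i : ℝ) + ((hi i : ℝ) - lo i) * γ i = T₂) :
    SDECUpTo x Q (M₁ + M₂) (lconv M₁ M₂ μ₁ (fun h => ∑ i, w i * TP[lo i, hi i, γ i, h])) := by
  have hx1 : x ≤ 1 := by
    rcases isEmpty_or_nonempty ι with hι | ⟨⟨i⟩⟩
    · simp at hw1
    · exact (hγ i).1.trans (hγ i).2
  exact sdecUpTo_lconv_twoPointMix x Q T₂ M₁ M₂ μ₁ w γ lo hi hx0 hQ1 hQx hμ0 hμM hμ1 hta hS hx1 hw0 hw1
    (fun i => ⟨hx0.le.trans (hγ i).1, (hγ i).2⟩) hlohi hhi (fun i _ _ => (hγ i).1) (fun i _ => hmeans i)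
    (fun i _ _ => sdecUpTo_slice_of_windowMix hCW x Q (γ i) (hi i - lo i) M₁ μ₁ hx0 hQ1 hQx (hγ i).1 (hγ i).2 (by omega)
      hμ0 hμM hμ1 hta hS)


/-- `sdecUpTo_lconv_heavyMix_of_windowMix` with the heaviness and the common mean required of CHARGED genuine components only
(the form delivered by Lemma P). CONDITIONAL on CW. [this work] -/
theorem sdecUpTo_lconv_heavyMix_of_windowMix' (hCW : WindowMixDEC) (x Q T₂ : ℝ) (M₁ M₂ : ℕ) (μ₁ : ℕ → ℝ) {ι : Type} [Fintype ι]
    (w γ : ι → ℝ) (lo hi : ι → ℕ)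
    (hx0 : 0 < x) (hx1 : x ≤ 1) (hQ1 : Q ≤ 1) (hQx : Q * x < 1)
    (hμ0 : ∀ h, 0 ≤ μ₁ h) (hμM : ∀ h, M₁ < h → μ₁ h = 0) (hμ1 : ∑ h ∈ Finset.range (M₁ + 1), μ₁ h = 1)
    (hta : x * (M₁ : ℝ) ≤ ∑ h ∈ Finset.range (M₁ + 1), (h : ℝ) * μ₁ h) (hS : SDECUpTo x Q M₁ μ₁)
    (hw0 : ∀ i, 0 ≤ w i) (hw1 : ∑ i, w i = 1) (hγ : ∀ i, 0 ≤ γ i ∧ γ i ≤ 1) (hlohi : ∀ i, lo i ≤ hi i) (hhi : ∀ i, hi i ≤ M₂)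
    (hheavy : ∀ i, 0 < w i → lo i < hi i → x ≤ γ i)
    (hmeans : ∀ i, 0 < w i → (lo i : ℝ) + ((hi i : ℝ) - lo i) * γ i = T₂) :
    SDECUpTo x Q (M₁ + M₂) (lconv M₁ M₂ μ₁ (fun h => ∑ i, w i * TP[lo i, hi i, γ i, h])) :=
  sdecUpTo_lconv_twoPointMix x Q T₂ M₁ M₂ μ₁ w γ lo hi hx0 hQ1 hQx hμ0 hμM hμ1 hta hS hx1 hw0 hw1 hγ hlohi hhi hheavy hmeans
    (fun i hi0 hlt => sdecUpTo_slice_of_windowMix hCW x Q (γ i) (hi i - lo i) M₁ μ₁ hx0 hQ1 hQx (hheavy i hi0 hlt) (hγ i).2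
      (by omega) hμ0 hμM hμ1 hta hS)

/-- **UNCONDITIONAL: a GAPPED first factor.**  If `μ₁` (top-affordable probability law on `{0..M₁}`, SDEC up to `Q` at `x`) has NO ATOM STRICTLY
INSIDE `(0, A)` and `μ₂` is a finite mixture of heavy two-point laws `{lo i, hi i; γ i}` of a common mean with blob sizes `hi i − lo i ≤ A`, then
`lconv μ₁ μ₂` is SDEC up to `Q` at `x` (`sdecUpTo_slice_of_gap` for the blob slices; for `A = 1` every law is gapped and `μ₂` is a mixture of
adjacent pairs). [this work] -/
theorem sdecUpTo_lconv_heavyMix_of_gap (x Q T₂ : ℝ) (M₁ M₂ A : ℕ) (μ₁ : ℕ → ℝ) {ι : Type} [Fintype ι]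
    (w γ : ι → ℝ) (lo hi : ι → ℕ)
    (hx0 : 0 < x) (hQ1 : Q ≤ 1) (hQx : Q * x < 1)
    (hμ0 : ∀ h, 0 ≤ μ₁ h) (hμM : ∀ h, M₁ < h → μ₁ h = 0) (hμ1 : ∑ h ∈ Finset.range (M₁ + 1), μ₁ h = 1)
    (hta : x * (M₁ : ℝ) ≤ ∑ h ∈ Finset.range (M₁ + 1), (h : ℝ) * μ₁ h) (hS : SDECUpTo x Q M₁ μ₁)
    (hgap : ∀ k, 0 < k → k < A → μ₁ k = 0)
    (hw0 : ∀ i, 0 ≤ w i) (hw1 : ∑ i, w i = 1) (hγ : ∀ i, x ≤ γ i ∧ γ i ≤ 1) (hlohi : ∀ i, lo i ≤ hi i) (hhi : ∀ i, hi i ≤ M₂)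
    (hsize : ∀ i, hi i - lo i ≤ A) (hmeans : ∀ i, (lo i : ℝ) + ((hi i : ℝ) - lo i) * γ i = T₂) :
    SDECUpTo x Q (M₁ + M₂) (lconv M₁ M₂ μ₁ (fun h => ∑ i, w i * TP[lo i, hi i, γ i, h])) := by
  have hx1 : x ≤ 1 := by
    rcases isEmpty_or_nonempty ι with hι | ⟨⟨i⟩⟩
    · simp at hw1
    · exact (hγ i).1.trans (hγ i).2
  exact sdecUpTo_lconv_twoPointMix x Q T₂ M₁ M₂ μ₁ w γ lo hi hx0 hQ1 hQx hμ0 hμM hμ1 hta hS hx1 hw0 hw1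
    (fun i => ⟨hx0.le.trans (hγ i).1, (hγ i).2⟩) hlohi hhi (fun i _ _ => (hγ i).1) (fun i _ => hmeans i)
    (fun i _ _ => sdecUpTo_slice_of_gap x Q (γ i) (hi i - lo i) M₁ μ₁ hx0 hQ1 hQx (hγ i).1 (hγ i).2 (by omega)
      hμ0 hμM hμ1 hta (fun k hk hkA => hgap k hk (lt_of_lt_of_le hkA (hsize i))) hS)

/-- **UNCONDITIONAL: TWO HEAVY MIXTURES.**  If `μ₁ = Σ_i w_i·{lo i, hi i; γ i}` and `μ₂ = Σ_k v_k·{lo′ k, hi′ k; γ′ k}` are finite mixtures of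
HEAVY (`≥ x`) two-point laws on `{0..M₁}`, `{0..M₂}` with common means `T₁`, `T₂`, then `lconv μ₁ μ₂` is SDEC up to every level `Q ≤ 1` with
`Qx < 1` at floor `x`: `SingleGateConvClosed` holds unconditionally for heavy-decomposable pairs (in particular for two self-standing gated
two-point laws with heavy tops, for two blob laws — BLOB-DEC(2) under a common gate —, and for laws whose only atom below the mean is `0`).
Proof: the blob slices of a heavy mixture are heavy mixtures again?  No — directly: by `sdecUpTo_lconv_twoPointMix` it suffices that each blob slice
`slice μ₁ b γ′` is SDEC up to `Q`; `slice μ₁ b γ′ = lconv (TP[0,b,γ′]) μ₁` up to the order of the factors, and THAT is a heavy mixture (`μ₁`) beside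
the GAPPED law `TP[0, b, γ′]` (no atom in `(0, b)`), i.e. `sdecUpTo_lconv_heavyMix_of_gap` with `A = b`... except that the blob sizes of `μ₁` are not
bounded by `b`; so instead slice each COMPONENT: `gate_q` of `μ₁ ∗ {lo′, hi′; γ′}` is the mixture over `i` of the gated `(lo i + lo′)`-shifts of the
TWO-BLOB laws `slice TP[0, hi i − lo i, γ i] (hi′ − lo′) γ′` (`sdecUpTo_twoBlob`). [this work] -/
theorem sdecUpTo_lconv_heavyMix_heavyMix (x Q T₁ T₂ : ℝ) (M₁ M₂ : ℕ) {ι κ : Type} [Fintype ι] [Fintype κ]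
    (w γ : ι → ℝ) (lo hi : ι → ℕ) (v γ' : κ → ℝ) (lo' hi' : κ → ℕ)
    (hx0 : 0 < x) (hQ1 : Q ≤ 1) (hQx : Q * x < 1)
    (hw0 : ∀ i, 0 ≤ w i) (hw1 : ∑ i, w i = 1) (hγ : ∀ i, x ≤ γ i ∧ γ i ≤ 1) (hlohi : ∀ i, lo i ≤ hi i) (hhi : ∀ i, hi i ≤ M₁)
    (hmeans : ∀ i, (lo i : ℝ) + ((hi i : ℝ) - lo i) * γ i = T₁) (hta₁ : x * (M₁ : ℝ) ≤ T₁)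
    (hv0 : ∀ k, 0 ≤ v k) (hv1 : ∑ k, v k = 1) (hγ' : ∀ k, x ≤ γ' k ∧ γ' k ≤ 1) (hlohi' : ∀ k, lo' k ≤ hi' k)
    (hhi' : ∀ k, hi' k ≤ M₂) (hmeans' : ∀ k, (lo' k : ℝ) + ((hi' k : ℝ) - lo' k) * γ' k = T₂) :
    SDECUpTo x Q (M₁ + M₂) (lconv M₁ M₂ (fun h => ∑ i, w i * TP[lo i, hi i, γ i, h]) (fun h => ∑ k, v k * TP[lo' k, hi' k, γ' k, h])) := by
  have hγ0 : ∀ i, 0 ≤ γ i ∧ γ i ≤ 1 := fun i => ⟨hx0.le.trans (hγ i).1, (hγ i).2⟩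
  obtain ⟨m0, mM, m1, mmean⟩ := twoPointMix_laws M₁ T₁ w γ lo hi hw0 hw1 hγ0 hlohi hhi (fun i _ => hmeans i)
  -- `μ₁` is itself SDEC up to `Q`: the case of the first factor `δ₀` (`lconv δ₀ μ₁ = μ₁`)
  have hx1 : x ≤ 1 := by
    rcases isEmpty_or_nonempty ι with hι | ⟨⟨i⟩⟩
    · simp at hw1
    · exact (hγ i).1.trans (hγ i).2
  have hδ : ∀ (μ : ℕ → ℝ) (M : ℕ), (∀ h, M < h → μ h = 0) → lconv 0 M (fun h => if h = 0 then (1 : ℝ) else 0) μ = μ := by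
    intro μ M hM
    funext t
    rw [lconv_point_left 0 M μ hM t]
    simp
  have hS₁ : SDECUpTo x Q M₁ (fun h => ∑ i, w i * TP[lo i, hi i, γ i, h]) := by
    have h := sdecUpTo_lconv_twoPointMix x Q T₁ 0 M₁ (fun h => if h = 0 then (1 : ℝ) else 0) w γ lo hi hx0 hQ1 hQx
      (fun h => by show (0 : ℝ) ≤ (if h = 0 then (1 : ℝ) else 0); split_ifs <;> norm_num)
      (fun h hh => by show (if h = 0 then (1 : ℝ) else 0) = 0; rw [if_neg (by omega)]) (by simp) (by simp)
      (fun q _ _ j hj => absurd hj (Nat.not_lt_zero j)) hx1 hw0 hw1 hγ0 hlohi hhi (fun i _ _ => (hγ i).1) (fun i _ => hmeans i)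
      (fun i _ hlt => by
        rw [slice_delta_zero _ _ (by omega), Nat.zero_add]
        exact sdecUpTo_blob x Q (γ i) (hi i - lo i) hx0 hQ1 hQx (hγ i).1 (hγ i).2 (by omega))
    rwa [hδ _ M₁ mM, Nat.zero_add] at h
  have hγ'0 : ∀ k, 0 ≤ γ' k ∧ γ' k ≤ 1 := fun k => ⟨hx0.le.trans (hγ' k).1, (hγ' k).2⟩
  refine sdecUpTo_lconv_twoPointMix x Q T₂ M₁ M₂ _ v γ' lo' hi' hx0 hQ1 hQx m0 mM m1 (by rw [mmean]; exact hta₁) hS₁ hx1 hv0 hv1 hγ'0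
    hlohi' hhi' (fun k _ _ => (hγ' k).1) (fun k _ => hmeans' k) (fun k _ hlt => ?_)
  -- the blob slice of the heavy mixture `μ₁` by `{0, b; γ′ k}`, `b = hi′ k − lo′ k ≥ 1`: commute and decompose `μ₁`
  set b : ℕ := hi' k - lo' k with hb
  have hb1 : 1 ≤ b := by omega
  have eslice : slice (fun h => ∑ i, w i * TP[lo i, hi i, γ i, h]) b (γ' k)
      = lconv b M₁ (fun h => TP[0, b, γ' k, h]) (fun h => ∑ i, w i * TP[lo i, hi i, γ i, h]) := by
    rw [lconv_comm, lconv_TP_eq_shift_slice M₁ b 0 b _ (γ' k) mM (Nat.zero_le _) le_rfl]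
    funext t; simp
  rw [eslice, Nat.add_comm]
  obtain ⟨b0, bM, bsum, bmean⟩ := blob_laws b (γ' k) (hx0.le.trans (hγ' k).1) (hγ' k).2
  exact sdecUpTo_lconv_twoPointMix x Q T₁ b M₁ (fun h => TP[0, b, γ' k, h]) w γ lo hi hx0 hQ1 hQx b0 bM bsum
    (by rw [bmean, mul_comm]; exact mul_le_mul_of_nonneg_left (hγ' k).1 (Nat.cast_nonneg b))
    (sdecUpTo_blob x Q (γ' k) b hx0 hQ1 hQx (hγ' k).1 (hγ' k).2 hb1) hx1 hw0 hw1 hγ0 hlohi hhi (fun i _ _ => (hγ i).1)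
    (fun i _ => hmeans i)
    (fun i _ hlt => by
      rw [slice_blob_comm]
      have h := sdecUpTo_twoBlob x Q (γ i) (γ' k) (hi i - lo i) b hx0 hQ1 hQx (hγ i).1 (hγ i).2 (hγ' k).1 (hγ' k).2 (by omega) hb1
      rwa [Nat.add_comm] at h)


/-- **`WindowMixDEC ⟹` THE CONCLUSION OF `SingleGateConvClosed` FOR EVERY ZERO-OR-BIG SECOND FACTOR** (a law whose only atom below its mean
is `0`: "when the subtree reaches anything it reaches at least its mean number of relays").  Such a law is heavy-decomposable: in Lemma P
(`exists_twoPoint_decomposition_TA`) every genuine pair is `{0, h; T₂/h}` with `T₂/h ≥ x` by top-affordability.  CONDITIONAL on CW.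
[this work] -/
theorem sdecUpTo_lconv_zeroOrBig_of_windowMix (hCW : WindowMixDEC) (x Q : ℝ) (M₁ M₂ : ℕ) (μ₁ μ₂ : ℕ → ℝ)
    (hx0 : 0 < x) (hx1 : x ≤ 1) (hQ1 : Q ≤ 1) (hQx : Q * x < 1)
    (hμ0 : ∀ h, 0 ≤ μ₁ h) (hμM : ∀ h, M₁ < h → μ₁ h = 0) (hμ1 : ∑ h ∈ Finset.range (M₁ + 1), μ₁ h = 1)
    (hta : x * (M₁ : ℝ) ≤ ∑ h ∈ Finset.range (M₁ + 1), (h : ℝ) * μ₁ h) (hS : SDECUpTo x Q M₁ μ₁)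
    (hν0 : ∀ h, 0 ≤ μ₂ h) (hνM : ∀ h, M₂ < h → μ₂ h = 0) (hν1 : ∑ h ∈ Finset.range (M₂ + 1), μ₂ h = 1)
    (hta₂ : x * (M₂ : ℝ) ≤ ∑ h ∈ Finset.range (M₂ + 1), (h : ℝ) * μ₂ h)
    (hzb : ∀ k, 0 < μ₂ k → (k : ℝ) < ∑ h ∈ Finset.range (M₂ + 1), (h : ℝ) * μ₂ h → k = 0) :
    SDECUpTo x Q (M₁ + M₂) (lconv M₁ M₂ μ₁ μ₂) := by
  set T₂ : ℝ := ∑ h ∈ Finset.range (M₂ + 1), (h : ℝ) * μ₂ h with hT₂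
  have htop : ∀ h, 0 < μ₂ h → x * (h : ℝ) ≤ T₂ := by
    intro h hh
    have hhM : h ≤ M₂ := by
      by_contra hc
      exact (ne_of_gt hh) (hνM h (not_le.1 hc))
    exact (mul_le_mul_of_nonneg_left (by exact_mod_cast hhM) hx0.le).trans hta₂
  obtain ⟨lam, g, lo, hi, h0, h1, hg, hlohi, hhi, hμ, hgen⟩ :=
    exists_twoPoint_decomposition_TA M₂ M₂ le_rfl μ₂ hν0 hνM hν1 x htop
  have e : μ₂ = fun h => ∑ r, lam r * TP[lo r, hi r, g r, h] := funext hμ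
  rw [e]
  refine sdecUpTo_lconv_heavyMix_of_windowMix' hCW x Q T₂ M₁ M₂ μ₁ lam g lo hi hx0 hx1 hQ1 hQx hμ0 hμM hμ1 hta hS h0 h1 hg hlohi hhi
    (fun r hr hlt => ?_) (fun r hr => (hgen r hr).2.2.1)
  -- a genuine pair of a zero-or-big law is `{0, hi; T₂/hi}`, heavy by top-affordability
  obtain ⟨hlo0, _, hmean, hstr, htahi⟩ := hgen r hr
  have hlo : lo r = 0 := hzb (lo r) hlo0 (hstr hlt).1
  rw [hlo, Nat.cast_zero, zero_add, sub_zero] at hmean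
  have hhi0' : 0 < hi r := by omega
  have hhi0 : (0 : ℝ) < hi r := by exact_mod_cast hhi0'
  rw [← hmean] at htahi
  have h2 : x * (hi r : ℝ) ≤ g r * (hi r : ℝ) := by rw [mul_comm (g r)]; exact htahi
  exact le_of_mul_le_mul_right h2 hhi0

end LawDec

end Quant

end Summit.CriticalPhenomena.PercolationContinuityZ3.Theorems
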